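import Mathlib.RingTheory.AdjoinRoot
import Mathlib.Algebra.Polynomial.Degree.Support
import Mathlib.Algebra.BigOperators.Fin
import Literature.Computability.Complexity.Classes
import Literature.Computability.Complexity.BoolEncodings
import Literature.Computability.Complexity.ReductionsProofs
import Literature.Computability.Complexity.StringEquality
import Literature.Computability.Complexity.BrickAlgebra
import HarnessLib

/-!
# Number-field isomorphism is decidable in polynomial time (Landau 1985; A. K. Lenstra 1983)

Two number fields presented by defining polynomials, `K_p = ℚ[X]/(p)` and `K_q = ℚ[X]/(q)` with
`p, q ∈ ℤ[X]` monic irreducible, are isomorphic iff `q` has a linear factor over `K_p` and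
`deg p = deg q`; since polynomials over an algebraic number field can be factored into
irreducibles in deterministic polynomial time (A. K. Lenstra 1983, Thm. (3.7); Landau 1985 —
both resting on the Lenstra–Lenstra–Lovász algorithm for `ℚ[X]`, LLL 1982 Thm. (3.6)), the
isomorphism problem for number fields is in `P`. The corollary is printed in exactly this
form in H. W. Lenstra's survey (Bull. AMS 26 (1992), §2.9): "given two number fields
`K = ℚ(α)` and `K'`, one can decide whether or not they are isomorphic, and if so, find all
isomorphisms, in polynomial time."

This file VENDORS that result as ONE named fact (D-0014; nothing here is `sorry`d):

* `encodingIntPoly : Computability.Encoding ℤ[X] Bool` — an integer polynomial is the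
  `listBool`/`encodingIntBool` code of its ascending coefficient list
  `(List.range (p.natDegree + 1)).map p.coeff` (`coeffsAsc`; this is literally the encoding
  used by the route `Summits/PneNP/PneNP/Theses/CanonicalForms.lean`, decl `NumberFieldNoCF`),
  with a genuine decoder `ofCoeffsAsc` (`ofCoeffsAsc_coeffsAsc`);
* `monicIrredLang` — codes of monic irreducible `p ∈ ℤ[X]`; `nfIsoLang` — pair codes
  `⟨p, q⟩ = boolPair (code p) (code q)` of monic irreducible `p, q` with
  `ℚ[X]/(p) ≃ₐ[ℚ] ℚ[X]/(q)` (`AdjoinRoot`);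
* the named fact `nfIso_mem_P : nfIsoLang ∈ Classes.P` [Landau1985; Lenstra1983, Thm. (3.7);
  Lenstra1992, §2.9], requested by ledger item wi-07796 for route PneNP/CanonicalForms;
* PROVED consequences in the shape that route consumes: the companion fact
  "irreducibility of (monic) integer polynomials is decidable in `P`" (LLL 1982, Thm. (3.6))
  is *derived* here as `monicIrredLang_mem_P : nfIso_mem_P → monicIrredLang ∈ P` (the
  diagonal `x ↦ ⟨x, x⟩` is an `FP` reduction, `copyFn`), and the equivalence relation
  `nfEquiv` on ALL bit strings ("both strings code monic irreducible polynomials with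
  isomorphic fields, or neither string is such a code") is an `Equivalence` whose
  pair-language `{w | ∃ x y, w = ⟨x, y⟩ ∧ nfEquiv x y}` is in `P` (`pairLang_nfEquiv_mem_P`),
  i.e. exactly the data of a "P-decidable equivalence relation" in the sense of
  Blass–Gurevich / Fortnow–Grochow.

## Design notes

* The fact is stated in FULL-LANGUAGE form (non-codes and codes of reducible or non-monic
  polynomials lie outside `nfIsoLang`), like `PRIMES_mem_P` in
  `Computability/QuantumComplexity/Factoring.lean`. Deciding it therefore also requires the
  polynomial-time irreducibility test over `ℚ` (LLL 1982, Thm. (3.6): a primitive — e.g.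
  monic — `f ∈ ℤ[X]` of degree `n` is factored into irreducibles in `ℤ[X]` in
  `O(n¹² + n⁹ (log |f|)³)` bit operations; for monic `f`, irreducibility in `ℤ[X]` and in
  `ℚ[X]` agree by Gauss's lemma), which is in any case the `K = ℚ` instance of the cited
  factoring theorems, plus routine parsing of the self-delimiting codes.
* Isomorphism is `≃ₐ[ℚ]` of the stem fields `AdjoinRoot (p.map (Int.castRingHom ℚ))`; for
  fields of characteristic `0` this is the same as ring isomorphism.
* Deliberately NOT here: the machine (an `FP` decider would discharge `nfIso_mem_P`; it needs
  LLL reduction and factoring over number fields on Mathlib's `TM2` model — a theory, not a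
  lemma), the subfield / embedding problem, and canonical defining polynomials (`polredabs`,
  Cohen GTM 138 §4.4), which are the subject of the route's crux, not known mathematics.

## References

* S. Landau, *Factoring polynomials over algebraic number fields*, SIAM J. Comput. 14 (1985)
  184–195, main theorem (p. 184: "if `f(x)` is a polynomial in `ℤ[α][x]`, where `α` satisfies a
  monic irreducible polynomial over `ℤ`, then `f(x)` can be factored over `ℚ(α)[x]` in
  polynomial time"); erratum ibid. 20 (1991) 998. [Landau1985]
* A. K. Lenstra, *Factoring polynomials over algebraic number fields*, EUROCAL '83, LNCS 162
  (1983) 245–254 (= Math. Centrum report IW 213/82), Thm. (3.7). [Lenstra1983]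
* A. K. Lenstra, H. W. Lenstra Jr., L. Lovász, *Factoring polynomials with rational
  coefficients*, Math. Ann. 261 (1982) 515–534, Thm. (3.6). [LenstraLenstraLovasz1982]
* H. W. Lenstra Jr., *Algorithms in algebraic number theory*, Bull. AMS 26 (1992) 211–244,
  §2.9 (isomorphism and all isomorphisms of number fields in polynomial time). [Lenstra1992]
* H. Cohen, *A Course in Computational Algebraic Number Theory*, GTM 138, §4.5.4 "The Field
  Isomorphism Problem": Prop. 4.5.3 (degree-one factors of `A` in `L[X]` ↔ conjugates of `α`
  in `L`) and Algorithm 4.5.6 (field isomorphism using polynomial factorisation over number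
  fields, Algorithm 3.6.4). [Cohen1993]
-/

open Polynomial

namespace Literature.NumberTheory.NumberFields

open _root_.Computability Literature.Computability.Complexity

/-! ### The coefficient-list code of an integer polynomial -/

/-- The ascending coefficient list `[p₀, p₁, …, p_d]`, `d = natDegree p`, of an integer
polynomial (so `coeffsAsc 0 = [0]`; compare Mathlib's *descending* `Polynomial.coeffList`,
which is `[]` at `0`). This is the list the route PneNP/CanonicalForms feeds to
`encodingIntBool.listBool`. [folklore] -/
def coeffsAsc (p : ℤ[X]) : List ℤ :=
  (List.range (p.natDegree + 1)).map p.coeff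

/-- `coeffsAsc p` has length `natDegree p + 1`. [folklore] -/
@[simp] theorem length_coeffsAsc (p : ℤ[X]) : (coeffsAsc p).length = p.natDegree + 1 := by
  simp [coeffsAsc]

/-- The `i`-th entry of `coeffsAsc p` (default `0` past the end) is `p.coeff i`. [folklore] -/
theorem getD_coeffsAsc (p : ℤ[X]) (i : ℕ) : (coeffsAsc p).getD i 0 = p.coeff i := by
  unfold coeffsAsc
  by_cases hi : i < p.natDegree + 1
  · rw [List.getD_eq_getElem _ _ (by simpa using hi)]
    simp
  · rw [List.getD_eq_default _ _ (by simpa using not_lt.mp hi)]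
    exact (coeff_eq_zero_of_natDegree_lt (by omega)).symm

/-- The integer polynomial with ascending coefficient list `l`:
`ofCoeffsAsc l = ∑_{i < |l|} lᵢ Xⁱ`, written — literally as in the route's decl
`NumberFieldNoCF` — as a sum over `Fin l.length` of monomials. [folklore] -/
noncomputable def ofCoeffsAsc (l : List ℤ) : ℤ[X] :=
  ∑ i : Fin l.length, monomial (i : ℕ) (l.get i)

/-- `ofCoeffsAsc` as a sum over `Finset.range`. [folklore] -/
theorem ofCoeffsAsc_eq_sum_range (l : List ℤ) :
    ofCoeffsAsc l = ∑ i ∈ Finset.range l.length, monomial i (l.getD i 0) := by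
  unfold ofCoeffsAsc
  rw [Finset.sum_fin_eq_sum_range]
  refine Finset.sum_congr rfl fun i hi => ?_
  rw [Finset.mem_range] at hi
  rw [dif_pos hi, List.getD_eq_getElem _ _ hi]
  simp

/-- Decoding the coefficient list recovers the polynomial: `ofCoeffsAsc (coeffsAsc p) = p`
(Mathlib's `Polynomial.as_sum_range`). [folklore] -/
theorem ofCoeffsAsc_coeffsAsc (p : ℤ[X]) : ofCoeffsAsc (coeffsAsc p) = p := by
  rw [ofCoeffsAsc_eq_sum_range, length_coeffsAsc]
  conv_rhs => rw [p.as_sum_range]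
  exact Finset.sum_congr rfl fun i _ => by rw [getD_coeffsAsc]

/-- **The Boolean encoding of integer polynomials** used for number-field inputs: `p ↦` the
`listBool`-code (over `encodingIntBool`) of its ascending coefficient list, decoded by
`ofCoeffsAsc`. A genuine `Computability.Encoding` (`decode (encode p) = some p`), hence
injective. [Arora–Barak 2009, §0.1 (representing objects as strings)] [cite: AroraBarak2009, §0.1] -/
noncomputable def encodingIntPoly : Encoding ℤ[X] Bool where
  encode p := encodingIntBool.listBool.encode (coeffsAsc p)
  decode w := (encodingIntBool.listBool.decode w).map ofCoeffsAsc
  decode_encode p := by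
    rw [encodingIntBool.listBool.decode_encode, Option.map_some, ofCoeffsAsc_coeffsAsc]

/-- The code of `p` is literally `encodingIntBool.listBool.encode ((List.range (p.natDegree +
1)).map p.coeff)` (the expression in the route file). [folklore] -/
@[simp] theorem encodingIntPoly_encode (p : ℤ[X]) :
    encodingIntPoly.encode p =
      encodingIntBool.listBool.encode ((List.range (p.natDegree + 1)).map p.coeff) :=
  rfl

/-- The integer-list decoder reads the code of `p` as `coeffsAsc p`. [folklore] -/
@[simp] theorem listBool_decode_encodingIntPoly_encode (p : ℤ[X]) :
    encodingIntBool.listBool.decode (encodingIntPoly.encode p) = some (coeffsAsc p) :=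
  encodingIntBool.listBool.decode_encode _

/-- `encodingIntPoly.encode` is injective. [folklore] -/
theorem encodingIntPoly_encode_injective : Function.Injective encodingIntPoly.encode :=
  encodingIntPoly.encode_injective

/-! ### The languages -/

/-- `IsoStemFields p q`: the stem algebras `ℚ[X]/(p)` and `ℚ[X]/(q)` (`AdjoinRoot` of the
images of `p, q ∈ ℤ[X]` in `ℚ[X]`) are isomorphic as `ℚ`-algebras. For monic irreducible
`p, q` these are the number fields defined by `p` and `q`. [Lenstra 1992, §2.9; Cohen GTM 138,
§4.5.4, Prop. 4.5.3 and Algorithm 4.5.6] [cite: Lenstra1992, §2.9] -/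
def IsoStemFields (p q : ℤ[X]) : Prop :=
  Nonempty (AdjoinRoot (p.map (Int.castRingHom ℚ)) ≃ₐ[ℚ] AdjoinRoot (q.map (Int.castRingHom ℚ)))

/-- `IsoStemFields` is reflexive. [folklore] -/
theorem IsoStemFields.refl (p : ℤ[X]) : IsoStemFields p p := ⟨AlgEquiv.refl⟩

/-- `IsoStemFields` is symmetric. [folklore] -/
theorem IsoStemFields.symm {p q : ℤ[X]} (h : IsoStemFields p q) : IsoStemFields q p :=
  ⟨h.some.symm⟩

/-- `IsoStemFields` is transitive. [folklore] -/
theorem IsoStemFields.trans {p q r : ℤ[X]} (h₁ : IsoStemFields p q) (h₂ : IsoStemFields q r) :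
    IsoStemFields p r :=
  ⟨h₁.some.trans h₂.some⟩

/-- **`monicIrredLang`**: the codes of monic irreducible integer polynomials (the valid
presentations `ℚ[X]/(p)` of a number field by a defining polynomial). [Lenstra 1992, §2.9
("giving a number field is equivalent to giving an irreducible polynomial `f` and letting the
field be `ℚ[X]/fℚ[X]`")] [cite: Lenstra1992, §2.9] -/
def monicIrredLang : Language Bool :=
  encodingIntPoly.toLanguage {p | p.Monic ∧ Irreducible p}

/-- **`nfIsoLang`**, the number-field isomorphism problem as a language: the pair codes
`⟨p, q⟩ = boolPair (code p) (code q)` of monic irreducible `p, q ∈ ℤ[X]` whose number fields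
`ℚ[X]/(p)`, `ℚ[X]/(q)` are isomorphic. [Lenstra 1992, §2.9] [cite: Lenstra1992, §2.9] -/
def nfIsoLang : Language Bool :=
  (encodingIntPoly.pairBool encodingIntPoly).toLanguage
    {pq | (pq.1.Monic ∧ Irreducible pq.1) ∧ (pq.2.Monic ∧ Irreducible pq.2) ∧
      IsoStemFields pq.1 pq.2}

/-- **Named fact `nfIso_mem_P` (number-field isomorphism is in `P`).** The language
`nfIsoLang` of pairs `⟨p, q⟩` of (codes of) monic irreducible integer polynomials with
`ℚ[X]/(p) ≅ ℚ[X]/(q)` is decidable in deterministic polynomial time (Mathlib's `TM2` model,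
`Classes.P`). As printed (Lenstra 1992, §2.9): "given two number fields `K = ℚ(α)` and `K'`,
one can decide whether or not they are isomorphic, and if so, find all isomorphisms, in
polynomial time. To do this, one factors the irreducible polynomial `f` of `α` over `ℚ` into
irreducible factors in the ring `K'[X]`, and one observes that the linear factors are in
bijective correspondence with the field homomorphisms `K → K'`; such a field homomorphism is
an isomorphism if and only if the two fields have the same degree over `ℚ`." The factoring
step is Landau 1985 (main theorem, p. 184: `f ∈ ℤ[α][x]`, `α` a root of a monic irreducible
integer polynomial, is factored over `ℚ(α)[x]` in polynomial time) and A. K. Lenstra 1983,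
Thm. (3.7); screening the inputs for irreducibility over `ℚ` is LLL 1982, Thm. (3.6).
Hypotheses complete: none beyond the input format (non-codes are rejected).
[cite: Landau1985, main theorem p. 184] [cite: Lenstra1983, Thm. (3.7)]
[cite: Lenstra1992, §2.9] -/
def nfIso_mem_P : Prop :=
  nfIsoLang ∈ Classes.P

/-! ### Membership lemmas -/

/-- A code lies in `monicIrredLang` iff the polynomial is monic irreducible. [folklore] -/
@[simp] theorem encode_mem_monicIrredLang_iff (p : ℤ[X]) :
    encodingIntPoly.encode p ∈ monicIrredLang ↔ p.Monic ∧ Irreducible p :=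
  encodingIntPoly.mem_toLanguage_iff _ p

/-- Membership in `monicIrredLang`, general strings. [folklore] -/
theorem mem_monicIrredLang_iff (x : List Bool) :
    x ∈ monicIrredLang ↔ ∃ p : ℤ[X], (p.Monic ∧ Irreducible p) ∧ encodingIntPoly.encode p = x :=
  Iff.rfl

/-- Membership of a pair `⟨x, y⟩` in `nfIsoLang`: both components are codes of monic
irreducible polynomials and the fields are isomorphic. [folklore] -/
theorem boolPair_mem_nfIsoLang_iff (x y : List Bool) :
    boolPair x y ∈ nfIsoLang ↔ ∃ p q : ℤ[X], encodingIntPoly.encode p = x ∧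
      encodingIntPoly.encode q = y ∧ (p.Monic ∧ Irreducible p) ∧ (q.Monic ∧ Irreducible q) ∧
        IsoStemFields p q := by
  constructor
  · rintro ⟨⟨p, q⟩, ⟨hp, hq, hiso⟩, he⟩
    have h₁ := congrArg Brick.fstF he
    have h₂ := congrArg Brick.sndF he
    simp only [Encoding.pairBool, Brick.fstF_boolPair, Brick.sndF_boolPair] at h₁ h₂
    exact ⟨p, q, h₁, h₂, hp, hq, hiso⟩
  · rintro ⟨p, q, rfl, rfl, hp, hq, hiso⟩
    exact ⟨(p, q), ⟨hp, hq, hiso⟩, rfl⟩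

/-- Membership of a pair of codes in `nfIsoLang`. [folklore] -/
@[simp] theorem boolPair_encode_mem_nfIsoLang_iff (p q : ℤ[X]) :
    boolPair (encodingIntPoly.encode p) (encodingIntPoly.encode q) ∈ nfIsoLang ↔
      (p.Monic ∧ Irreducible p) ∧ (q.Monic ∧ Irreducible q) ∧ IsoStemFields p q := by
  rw [boolPair_mem_nfIsoLang_iff]
  constructor
  · rintro ⟨p', q', hp', hq', hp, hq, hiso⟩
    cases encodingIntPoly_encode_injective hp'
    cases encodingIntPoly_encode_injective hq'
    exact ⟨hp, hq, hiso⟩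
  · rintro ⟨hp, hq, hiso⟩
    exact ⟨p, q, rfl, rfl, hp, hq, hiso⟩

/-- `nfIsoLang` is symmetric in the two components. [folklore] -/
theorem boolPair_mem_nfIsoLang_symm {x y : List Bool} (h : boolPair x y ∈ nfIsoLang) :
    boolPair y x ∈ nfIsoLang := by
  obtain ⟨p, q, rfl, rfl, hp, hq, hiso⟩ := (boolPair_mem_nfIsoLang_iff x y).1 h
  exact (boolPair_mem_nfIsoLang_iff _ _).2 ⟨q, p, rfl, rfl, hq, hp, hiso.symm⟩

/-- The components of a pair in `nfIsoLang` are valid codes. [folklore] -/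
theorem mem_monicIrredLang_of_boolPair_mem_nfIsoLang {x y : List Bool}
    (h : boolPair x y ∈ nfIsoLang) : x ∈ monicIrredLang ∧ y ∈ monicIrredLang := by
  obtain ⟨p, q, rfl, rfl, hp, hq, -⟩ := (boolPair_mem_nfIsoLang_iff x y).1 h
  exact ⟨(encode_mem_monicIrredLang_iff p).2 hp, (encode_mem_monicIrredLang_iff q).2 hq⟩

/-- `nfIsoLang` is transitive in the evident sense. [folklore] -/
theorem boolPair_mem_nfIsoLang_trans {x y z : List Bool} (h₁ : boolPair x y ∈ nfIsoLang)
    (h₂ : boolPair y z ∈ nfIsoLang) : boolPair x z ∈ nfIsoLang := by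
  obtain ⟨p, q, rfl, rfl, hp, hq, hpq⟩ := (boolPair_mem_nfIsoLang_iff x y).1 h₁
  obtain ⟨q', r, hq', rfl, -, hr, hqr⟩ := (boolPair_mem_nfIsoLang_iff _ z).1 h₂
  cases encodingIntPoly_encode_injective hq'
  exact (boolPair_mem_nfIsoLang_iff _ _).2 ⟨p, r, rfl, rfl, hp, hr, hpq.trans hqr⟩

/-- The diagonal of `nfIsoLang` is `monicIrredLang`: `⟨x, x⟩ ∈ nfIsoLang ↔ x ∈ monicIrredLang`.
[folklore] -/
theorem boolPair_self_mem_nfIsoLang_iff (x : List Bool) :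
    boolPair x x ∈ nfIsoLang ↔ x ∈ monicIrredLang := by
  constructor
  · exact fun h => (mem_monicIrredLang_of_boolPair_mem_nfIsoLang h).1
  · rintro ⟨p, hp, rfl⟩
    exact (boolPair_mem_nfIsoLang_iff _ _).2 ⟨p, p, rfl, rfl, hp, hp, IsoStemFields.refl p⟩

/-! ### Consequence 1: irreducibility of monic integer polynomials is in `P` -/

/-- `monicIrredLang` is the preimage of `nfIsoLang` under the copy map `x ↦ ⟨x, x⟩`.
[folklore] -/
theorem monicIrredLang_eq_preimage_copyFn : monicIrredLang = copyFn ⁻¹' nfIsoLang := by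
  ext x
  change x ∈ monicIrredLang ↔ copyFn x ∈ nfIsoLang
  rw [copyFn_apply, boolPair_self_mem_nfIsoLang_iff]

/-- **Irreducibility (with monicity) of integer polynomials is decidable in polynomial time**,
derived here from `nfIso_mem_P` via the `FP` reduction `x ↦ ⟨x, x⟩` (`copyFn_mem_FP`,
`preimage_mem_P`). The direct source is LLL 1982, Thm. (3.6): a primitive `f ∈ ℤ[X]` of degree
`n > 0` is factored into irreducible factors in `ℤ[X]` in `O(n¹² + n⁹ (log |f|)³)` bit
operations. [cite: LenstraLenstraLovasz1982, Thm. (3.6)] -/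
theorem monicIrredLang_mem_P (h : nfIso_mem_P) : monicIrredLang ∈ Classes.P := by
  rw [monicIrredLang_eq_preimage_copyFn]
  exact preimage_mem_P h copyFn_mem_FP

/-! ### Consequence 2: the `P`-decidable equivalence relation of number-field isomorphism -/

/-- **`nfEquiv`**, number-field isomorphism as an equivalence relation on ALL bit strings:
`x ~ y` iff `⟨x, y⟩ ∈ nfIsoLang` (both are codes of monic irreducible polynomials defining
isomorphic fields) or neither `x` nor `y` is a code of a monic irreducible polynomial (all
invalid strings form one class). [Fortnow–Grochow 2011, §2 (problems `PEq`); Lenstra 1992,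
§2.9] [cite: Lenstra1992, §2.9] -/
def nfEquiv (x y : List Bool) : Prop :=
  boolPair x y ∈ nfIsoLang ∨ (x ∉ monicIrredLang ∧ y ∉ monicIrredLang)

/-- On codes of monic irreducible polynomials `nfEquiv` is field isomorphism. [folklore] -/
theorem nfEquiv_encode_iff {p q : ℤ[X]} (hp : p.Monic ∧ Irreducible p)
    (hq : q.Monic ∧ Irreducible q) :
    nfEquiv (encodingIntPoly.encode p) (encodingIntPoly.encode q) ↔ IsoStemFields p q := by
  unfold nfEquiv
  rw [boolPair_encode_mem_nfIsoLang_iff, encode_mem_monicIrredLang_iff]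
  tauto

/-- A string equivalent to a valid code is itself a valid code with an isomorphic field:
`nfEquiv x (code p)` for monic irreducible `p` forces `x = code q` with `q` monic irreducible
and `ℚ[X]/(q) ≅ ℚ[X]/(p)`. [folklore] -/
theorem nfEquiv_encode_right_iff {p : ℤ[X]} (hp : p.Monic ∧ Irreducible p) (x : List Bool) :
    nfEquiv x (encodingIntPoly.encode p) ↔
      ∃ q : ℤ[X], x = encodingIntPoly.encode q ∧ (q.Monic ∧ Irreducible q) ∧ IsoStemFields q p := by
  constructor
  · rintro (h | ⟨-, h⟩)
    · obtain ⟨q, p', rfl, hp', hq, -, hiso⟩ := (boolPair_mem_nfIsoLang_iff _ _).1 h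
      cases encodingIntPoly_encode_injective hp'
      exact ⟨q, rfl, hq, hiso⟩
    · exact absurd ((encode_mem_monicIrredLang_iff p).2 hp) h
  · rintro ⟨q, rfl, hq, hiso⟩
    exact Or.inl ((boolPair_encode_mem_nfIsoLang_iff q p).2 ⟨hq, hp, hiso⟩)

/-- `nfEquiv` is reflexive. [folklore] -/
theorem nfEquiv_refl (x : List Bool) : nfEquiv x x := by
  by_cases hx : x ∈ monicIrredLang
  · exact Or.inl ((boolPair_self_mem_nfIsoLang_iff x).2 hx)
  · exact Or.inr ⟨hx, hx⟩

/-- `nfEquiv` is symmetric. [folklore] -/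
theorem nfEquiv_symm {x y : List Bool} (h : nfEquiv x y) : nfEquiv y x :=
  h.elim (fun h => Or.inl (boolPair_mem_nfIsoLang_symm h)) fun h => Or.inr ⟨h.2, h.1⟩

/-- `nfEquiv` is transitive. [folklore] -/
theorem nfEquiv_trans {x y z : List Bool} (h₁ : nfEquiv x y) (h₂ : nfEquiv y z) : nfEquiv x z := by
  rcases h₁ with h₁ | ⟨hx, hy⟩
  · rcases h₂ with h₂ | ⟨hy, hz⟩
    · exact Or.inl (boolPair_mem_nfIsoLang_trans h₁ h₂)
    · exact absurd (mem_monicIrredLang_of_boolPair_mem_nfIsoLang h₁).2 hy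
  · rcases h₂ with h₂ | ⟨-, hz⟩
    · exact absurd (mem_monicIrredLang_of_boolPair_mem_nfIsoLang h₂).1 hy
    · exact Or.inr ⟨hx, hz⟩

/-- **`nfEquiv` is an equivalence relation.** [folklore] -/
theorem nfEquiv_equivalence : Equivalence nfEquiv :=
  ⟨nfEquiv_refl, nfEquiv_symm, nfEquiv_trans⟩

/-- The language of genuine pair codes `{z | z = ⟨fst z, snd z⟩}` is in `P` (compare the input
with its re-pairing, `eqPairFn`). [Arora–Barak 2009, §1.3] [cite: AroraBarakCC2009, §1.3] -/
theorem setOf_eq_boolPair_mem_P :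
    ({z | z = boolPair (Brick.fstF z) (Brick.sndF z)} : Language Bool) ∈ Classes.P := by
  have h := setOf_apply_eq_apply_mem_P (f := fun z : List Bool => z)
    (g := fanoutFn Brick.fstF Brick.sndF) (PolyTimeComputable.id _)
    (fanoutFn_mem_FP Brick.fstF_mem_FP Brick.sndF_mem_FP)
  have hset : ({z | z = boolPair (Brick.fstF z) (Brick.sndF z)} : Language Bool) =
      {z | (fun z : List Bool => z) z = fanoutFn Brick.fstF Brick.sndF z} := by
    ext z
    change z = boolPair (Brick.fstF z) (Brick.sndF z) ↔ z = fanoutFn Brick.fstF Brick.sndF z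
    rw [fanoutFn_apply]
  rw [hset]
  exact h

/-- The pair-language of `nfEquiv`, decomposed into `P`-pieces: genuine pair codes whose
components are either an `nfIsoLang` pair or two invalid strings. [folklore] -/
theorem pairLang_nfEquiv_eq :
    ({w | ∃ x y, w = boolPair x y ∧ nfEquiv x y} : Language Bool) =
      ({z | z = boolPair (Brick.fstF z) (Brick.sndF z)} : Language Bool) ⊓
        ((fanoutFn Brick.fstF Brick.sndF ⁻¹' nfIsoLang : Language Bool) ⊔
          ((Brick.fstF ⁻¹' monicIrredLangᶜ : Language Bool) ⊓
            (Brick.sndF ⁻¹' monicIrredLangᶜ : Language Bool))) := by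
  ext w
  change (∃ x y, w = boolPair x y ∧ nfEquiv x y) ↔
    w = boolPair (Brick.fstF w) (Brick.sndF w) ∧
      (fanoutFn Brick.fstF Brick.sndF w ∈ nfIsoLang ∨
        Brick.fstF w ∉ monicIrredLang ∧ Brick.sndF w ∉ monicIrredLang)
  rw [fanoutFn_apply]
  constructor
  · rintro ⟨x, y, rfl, hE⟩
    rw [Brick.fstF_boolPair, Brick.sndF_boolPair]
    exact ⟨rfl, hE⟩
  · rintro ⟨hw, hE⟩
    exact ⟨Brick.fstF w, Brick.sndF w, hw, hE⟩

/-- **The pair-language of `nfEquiv` is in `P`** (given the named fact `nfIso_mem_P`): so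
`nfEquiv` is a polynomial-time decidable equivalence relation on `{0,1}*` in the sense of
Blass–Gurevich 1984 / Fortnow–Grochow 2011 (`PEq`). Assembled from `P`'s closure under `FP`
preimages, `∩`, `∪` and complement. [cite: Lenstra1992, §2.9] -/
theorem pairLang_nfEquiv_mem_P (h : nfIso_mem_P) :
    ({w | ∃ x y, w = boolPair x y ∧ nfEquiv x y} : Language Bool) ∈ Classes.P := by
  rw [pairLang_nfEquiv_eq]
  have hV : monicIrredLangᶜ ∈ Classes.P := compl_mem_P_iff.2 (monicIrredLang_mem_P h)
  refine inter_mem_P setOf_eq_boolPair_mem_P (union_mem_P ?_ (inter_mem_P ?_ ?_))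
  · exact preimage_mem_P h (fanoutFn_mem_FP Brick.fstF_mem_FP Brick.sndF_mem_FP)
  · exact preimage_mem_P hV Brick.fstF_mem_FP
  · exact preimage_mem_P hV Brick.sndF_mem_FP

/-- **Summary in the shape of a `PEq` witness**: under `nfIso_mem_P`, `nfEquiv` is an
equivalence relation on bit strings whose pair-language is in `P`. [cite: Lenstra1992, §2.9] -/
theorem nfEquiv_isPEq (h : nfIso_mem_P) :
    Equivalence nfEquiv ∧
      ({w | ∃ x y, w = boolPair x y ∧ nfEquiv x y} : Language Bool) ∈ Classes.P :=
  ⟨nfEquiv_equivalence, pairLang_nfEquiv_mem_P h⟩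

end Literature.NumberTheory.NumberFields
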